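import Mathlib

/-!
# `NoHeavyLowerTail` (crux stmt-CriticalPhenomena-4575), lane prim-ineq-gen-4 (gen 22): the FRAME CRITERION for non-singularity

Support file (`--supports stmt-CriticalPhenomena-4575`; memo `run/shared/lean/prim/prim-ineq-gen-4/FINDING-FRAMES-g22.md` §1).
No definitions, no `sorry`, standard axioms.

Abstract linear algebra behind the gen-22 certificates for the anti-band inequality (AB_l): let `M` be a symmetric matrix over a
linear ordered field, indexed by a finite partially ordered type `ι` (in the application: the ball `{x : #x ≤ k}` ordered by `⊆`,
`M x x' = C(n−1−#(x ∪ x'), k)`).  A *frame* is a family of vectors `w x : ι → R` (`x : ι`) with `w x` supported on the principal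
up-set of `x` (`w x y ≠ 0 → x ≤ y`) and `w x x ≠ 0`.  Write `W a = ∑ x, a x • w x` for the vector with frame coefficients `a`.
If the quadratic form `v ↦ v ⬝ᵥ M *ᵥ v` is positive on every non-zero `W a` with `a` supported in a class `P ⊆ ι` and negative on
every non-zero `W a` with `a` supported in the complement of `P`, then for EVERY upper set `U ⊆ ι` the principal submatrix `M_U`
is non-singular (indeed `{w x : x ∈ U}` is a triangular basis of `R^U` on which the form splits into a positive and a negative
definite part).  With the determinant criterion of gen 21 (`AntiBandDetCriterion`, `AntiBandShiftReduction`) this turns ONE pair of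
definite Gram matrices into (AB_l)(n) for all pairs of up-sets; explicit frames exist for all (n, k) with k ≤ 3 and for k = 4,
n ≤ 14 or n ≥ 24 (memo §2–§4, exact rational certificates).
-/

namespace Summit.CriticalPhenomena.PercolationContinuityZ3.Theorems.AntiBandFrameCriterion

open Finset Matrix

variable {ι : Type*} [Fintype ι] [DecidableEq ι] [PartialOrder ι]
variable {R : Type*} [Field R] [LinearOrder R] [IsStrictOrderedRing R]

omit [DecidableEq ι] [IsStrictOrderedRing R] in
/-- A frame vector whose coefficients vanish outside an upper set `U` vanishes outside `U`. [elementary] -/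
theorem frameVec_eq_zero_of_not_mem (w : ι → ι → R) (hsupp : ∀ x y, w x y ≠ 0 → x ≤ y)
    (U : Finset ι) (hU : IsUpperSet (U : Set ι)) (a : ι → R) (ha : ∀ x, x ∉ U → a x = 0)
    (y : ι) (hy : y ∉ U) : ∑ x, a x * w x y = 0 := by
  refine Finset.sum_eq_zero fun x _ => ?_
  by_cases hx : x ∈ U
  · by_cases hw : w x y = 0
    · rw [hw, mul_zero]
    · exact absurd (hU (hsupp x y hw) (Finset.mem_coe.2 hx)) (by simpa using hy)
  · rw [ha x hx, zero_mul]

omit [PartialOrder ι] [DecidableEq ι] [LinearOrder R] [IsStrictOrderedRing R] in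
/-- Restricting a quadratic-form value to an index set outside of which both vectors vanish. [elementary] -/
theorem dotProduct_mulVec_eq_submatrix (M : Matrix ι ι R) (U : Finset ι) (f g : ι → R)
    (hf : ∀ y, y ∉ U → f y = 0) (hg : ∀ y, y ∉ U → g y = 0) :
    f ⬝ᵥ (M *ᵥ g) =
      (fun y : ↥U => f y) ⬝ᵥ ((M.submatrix (Subtype.val : ↥U → ι) Subtype.val) *ᵥ fun y : ↥U => g y) := by
  classical
  have key : ∀ (h : ι → R), (∀ y, y ∉ U → h y = 0) → ∑ y, h y = ∑ y : ↥U, h y := by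
    intro h hh
    rw [Finset.sum_coe_sort U h]
    exact (Finset.sum_subset (Finset.subset_univ U) (fun y _ hy => hh y hy)).symm
  simp only [dotProduct, mulVec, submatrix_apply]
  rw [key (fun y => f y * ∑ y', M y y' * g y') (fun y hy => by rw [hf y hy, zero_mul])]
  refine Finset.sum_congr rfl fun y _ => ?_
  congr 1
  exact key (fun y' => M y y' * g y') (fun y' hy' => by rw [hg y' hy', mul_zero])

/-- **Frame criterion.**  `M` symmetric; `w x` supported on `{y | x ≤ y}` with `w x x ≠ 0`; the form `v ⬝ᵥ M *ᵥ v` positive on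
non-zero frame vectors with coefficients in the class `P` and negative on those with coefficients in `Pᶜ`.  Then every principal
submatrix of `M` on an upper set `U` has non-zero determinant. [gen 22, FINDING-FRAMES-g22.md §1] -/
theorem det_submatrix_ne_zero_of_frame (M : Matrix ι ι R) (hM : M.IsSymm) (w : ι → ι → R)
    (hsupp : ∀ x y, w x y ≠ 0 → x ≤ y) (hdiag : ∀ x, w x x ≠ 0) (P : ι → Prop) [DecidablePred P]
    (hpos : ∀ a : ι → R, (∀ x, ¬ P x → a x = 0) → a ≠ 0 →
      0 < (fun y => ∑ x, a x * w x y) ⬝ᵥ (M *ᵥ fun y => ∑ x, a x * w x y))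
    (hneg : ∀ a : ι → R, (∀ x, P x → a x = 0) → a ≠ 0 →
      (fun y => ∑ x, a x * w x y) ⬝ᵥ (M *ᵥ fun y => ∑ x, a x * w x y) < 0)
    (U : Finset ι) (hU : IsUpperSet (U : Set ι)) :
    (M.submatrix (Subtype.val : ↥U → ι) Subtype.val).det ≠ 0 := by
  classical
  set MU : Matrix ↥U ↥U R := M.submatrix (Subtype.val : ↥U → ι) Subtype.val with hMU
  intro hdet
  obtain ⟨v, hv0, hv⟩ := (Matrix.exists_mulVec_eq_zero_iff (M := MU)).2 hdet
  -- frame vectors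
  let frameVec : (ι → R) → ι → R := fun a y => ∑ x, a x * w x y
  -- extension by zero of coefficient vectors on `U`
  let ext : (↥U → R) → ι → R := fun c x => if h : x ∈ U then c ⟨x, h⟩ else 0
  have hext_out : ∀ c x, x ∉ U → ext c x = 0 := fun c x hx => by simp [ext, hx]
  have hext_in : ∀ c (x : ↥U), ext c x = c x := fun c x => by simp [ext, x.2]
  -- the frame map on `U`
  let Φ : (↥U → R) →ₗ[R] (↥U → R) :=
    { toFun := fun c y => frameVec (ext c) y
      map_add' := by
        intro c c'
        ext y
        simp only [frameVec, Pi.add_apply, ← Finset.sum_add_distrib, ← add_mul]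
        refine Finset.sum_congr rfl fun x _ => ?_
        by_cases hx : x ∈ U <;> simp [ext, hx]
      map_smul' := by
        intro r c
        ext y
        simp only [frameVec, Pi.smul_apply, smul_eq_mul, RingHom.id_apply, Finset.mul_sum, ← mul_assoc]
        refine Finset.sum_congr rfl fun x _ => ?_
        by_cases hx : x ∈ U <;> simp [ext, hx] }
  have hΦ : ∀ c (y : ↥U), Φ c y = ∑ x : ↥U, c x * w x y := by
    intro c y
    show frameVec (ext c) y = _
    simp only [frameVec]
    have h1 : ∑ x : ↥U, c x * w x y = ∑ x : ↥U, ext c x * w x y :=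
      Finset.sum_congr rfl fun x _ => by rw [hext_in]
    rw [h1, Finset.sum_coe_sort U (fun x => ext c x * w x y)]
    exact (Finset.sum_subset (Finset.subset_univ U) (fun x _ hx => by rw [hext_out c x hx, zero_mul])).symm
  -- Φ is injective: evaluate a vanishing combination at a minimal element of the support
  have hinj : Function.Injective Φ := by
    rw [← LinearMap.ker_eq_bot, LinearMap.ker_eq_bot']
    intro c hc
    by_contra hne
    have hsne : (Finset.univ.filter fun x : ↥U => c x ≠ 0).Nonempty := by
      by_contra hemp
      rw [Finset.not_nonempty_iff_eq_empty, Finset.filter_eq_empty_iff] at hemp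
      exact hne (funext fun x => by simpa using hemp (Finset.mem_univ x))
    obtain ⟨x₀, hx₀⟩ := Finset.exists_minimal hsne
    have hx₀s : c x₀ ≠ 0 := (Finset.mem_filter.1 hx₀.1).2
    have heval : Φ c x₀ = c x₀ * w x₀ x₀ := by
      rw [hΦ]
      refine Finset.sum_eq_single x₀ (fun x _ hx => ?_) (fun h => absurd (Finset.mem_univ _) h)
      by_cases hcx : c x = 0
      · rw [hcx, zero_mul]
      by_cases hwx : w x x₀ = 0
      · rw [hwx, mul_zero]
      exfalso
      have hle : x ≤ x₀ := hsupp x x₀ hwx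
      have hxs : x ∈ Finset.univ.filter fun x : ↥U => c x ≠ 0 := Finset.mem_filter.2 ⟨Finset.mem_univ _, hcx⟩
      exact hx (le_antisymm hle (hx₀.2 hxs hle))
    have : c x₀ * w x₀ x₀ = 0 := by rw [← heval, hc]; rfl
    rcases mul_eq_zero.1 this with h | h
    · exact hx₀s h
    · exact hdiag x₀ h
  -- hence surjective: v = Φ c
  obtain ⟨c, hcv⟩ := (LinearMap.injective_iff_surjective.1 hinj) v
  -- split the coefficients by the class P
  let cp : ↥U → R := fun x => if P x then c x else 0
  let cn : ↥U → R := fun x => if P x then 0 else c x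
  have hsplit : c = cp + cn := by
    funext x; by_cases hx : P (x : ι) <;> simp [cp, cn, hx]
  have hp_out : ∀ x, ¬ P x → ext cp x = 0 := by
    intro x hx; by_cases hxU : x ∈ U <;> simp [ext, cp, hxU, hx]
  have hn_out : ∀ x, P x → ext cn x = 0 := by
    intro x hx; by_cases hxU : x ∈ U <;> simp [ext, cn, hxU, hx]
  -- quadratic form values through the submatrix
  have hq : ∀ c₁ c₂ : ↥U → R,
      frameVec (ext c₁) ⬝ᵥ (M *ᵥ frameVec (ext c₂)) = Φ c₁ ⬝ᵥ (MU *ᵥ Φ c₂) := by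
    intro c₁ c₂
    rw [hMU, dotProduct_mulVec_eq_submatrix M U _ _
      (frameVec_eq_zero_of_not_mem w hsupp U hU (ext c₁) (hext_out c₁))
      (frameVec_eq_zero_of_not_mem w hsupp U hU (ext c₂) (hext_out c₂))]
    rfl
  have hsymm : ∀ f g : ↥U → R, f ⬝ᵥ (MU *ᵥ g) = g ⬝ᵥ (MU *ᵥ f) := by
    intro f g
    have hMUs : MU.IsSymm := by
      rw [hMU]; exact hM.submatrix _
    calc f ⬝ᵥ (MU *ᵥ g) = (f ᵥ* MU) ⬝ᵥ g := (dotProduct_mulVec f MU g)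
      _ = (MUᵀ *ᵥ f) ⬝ᵥ g := by rw [← vecMul_transpose]; rw [Matrix.transpose_transpose]
      _ = (MU *ᵥ f) ⬝ᵥ g := by rw [hMUs.eq]
      _ = g ⬝ᵥ (MU *ᵥ f) := dotProduct_comm _ _
  -- the key identity: (p - q) ⬝ MU (p + q) = 0 with p = Φ cp, q = Φ cn, p + q = v
  have hpq : Φ cp + Φ cn = v := by rw [← map_add, ← hsplit, hcv]
  have hzero : (Φ cp - Φ cn) ⬝ᵥ (MU *ᵥ (Φ cp + Φ cn)) = 0 := by
    rw [hpq, hv, dotProduct_zero]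
  have hexpand : (Φ cp - Φ cn) ⬝ᵥ (MU *ᵥ (Φ cp + Φ cn)) =
      Φ cp ⬝ᵥ (MU *ᵥ Φ cp) - Φ cn ⬝ᵥ (MU *ᵥ Φ cn) := by
    rw [mulVec_add, sub_dotProduct, dotProduct_add, dotProduct_add, hsymm (Φ cn) (Φ cp)]
    ring
  rw [hexpand] at hzero
  -- signs
  have hPp : 0 ≤ Φ cp ⬝ᵥ (MU *ᵥ Φ cp) ∧ (cp ≠ 0 → 0 < Φ cp ⬝ᵥ (MU *ᵥ Φ cp)) := by
    by_cases h0 : cp = 0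
    · refine ⟨?_, fun h => absurd h0 h⟩
      rw [h0, map_zero, zero_dotProduct]
    · have hne : ext cp ≠ 0 := by
        intro h
        apply h0
        funext x
        have := congrFun h x
        rwa [hext_in] at this
      have := hpos (ext cp) hp_out hne
      rw [hq] at this
      exact ⟨this.le, fun _ => this⟩
  have hNn : Φ cn ⬝ᵥ (MU *ᵥ Φ cn) ≤ 0 ∧ (cn ≠ 0 → Φ cn ⬝ᵥ (MU *ᵥ Φ cn) < 0) := by
    by_cases h0 : cn = 0
    · refine ⟨?_, fun h => absurd h0 h⟩
      rw [h0, map_zero, zero_dotProduct]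
    · have hne : ext cn ≠ 0 := by
        intro h
        apply h0
        funext x
        have := congrFun h x
        rwa [hext_in] at this
      have := hneg (ext cn) hn_out hne
      rw [hq] at this
      exact ⟨this.le, fun _ => this⟩
  have hcp0 : cp = 0 := by
    by_contra h
    have := hPp.2 h
    linarith [hNn.1]
  have hcn0 : cn = 0 := by
    by_contra h
    have := hNn.2 h
    linarith [hPp.1]
  apply hv0
  rw [← hcv, hsplit, hcp0, hcn0, add_zero, map_zero]

end Summit.CriticalPhenomena.PercolationContinuityZ3.Theorems.AntiBandFrameCriterion
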